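import Summits.ResolutionOfSingularities.ResolutionOfSingularities.Theses.HilbertSamuelElimination
import Summits.ResolutionOfSingularities.ResolutionOfSingularities.Theorems.HilbertSamuelEliminationSigmaMaxModificationsReductionBase
import Summits.ResolutionOfSingularities.ResolutionOfSingularities.Theorems.HilbertSamuelEliminationModificationsResolve
import Mathlib.AlgebraicGeometry.Morphisms.Proper
import Mathlib.AlgebraicGeometry.Noetherian
import HarnessLib

/-!
# `SigmaMaxModifications` (crux stmt-ResolutionOfSingularities-18506, route HilbertSamuelElimination)
— line `hs_curve_locus`: a LADDER DOWN from the crux (forward generator G4, seed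
`g4t-ResolutionOfSingularities-SigmaMaxModifications`, 2026-08-17)

**Top.** `C = SigmaMaxModifications`: for every prime `p`, field `k` of characteristic `p`, reduced
separated finite-type non-regular `X/k` and every `N ≥ dim X`, a `Σ^max`-modification at level `N`
(CJS, LNM 2270, Def. 6.15 in modification form; `B(X, N)` below = `HSBody X N`). `C → S` is landed
(`Theses.HilbertSamuelElimination.closes` with `Theorems.ModificationsResolve_proof`, CJS Cor. 6.18);
`S → C` is not (the tribunal's `C-strictly-harder-than-S-in-dim3`). After the lead's reshape 5 and
`sigmaMaxModifications_iff_base_cores` (p164038) the crux is, modulo the two printed theorems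
CJS Thm. 6.28 (`d ≤ 2`) and CP 2019 Thm. 1.1, the conjunction of `Corridor3@3` and `DimGe4@base`.

**Gradation (the crux's own language = the hypotheses of CJS Thm. 6.28, p. 90).** Thm. 6.28 is
DIMENSION-FREE: for excellent `X` of ANY dimension and `ν ∈ Σ^max_X` it produces the canonical
reduced `ν`-elimination provided (1) `char κ(x) = 0` or `≥ dim X / 2 + 1` on `X(ν)`,
(2) `dim X(ν) ≤ 1`, (3e) `ē_x(X) ≤ e ≤ 2` (directrix dimension) at the closed points of `X(ν)`,
(4e) a boundary condition that is empty for the empty boundary. Parameters: `d = dim X`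
(= binding level), `s = dim X_max(d)` (hyp. (2) is `s ≤ 1`), `p₀` = least characteristic allowed
(hyp. (1) in dimension `3` is `p ≥ 3`), and `e` (hyp. (3e); NOT typable — no directrix in the
tree). The typed family is `HSRung d s p₀`.

**Floor = witness.** `e ≤ 2` in every dimension: CJS Thm. 6.28 / 6.35 / 6.40 (print; reaches
`dim X ≥ 4`, where `S` is open). In the tree: `d ≤ 1` unconditional (`stub_curve`,
`stub_curveResolution`, p156715/p156708) and `d = 2` modulo the named fact
`CossartJannsenSaito2020_sigmaMaxElimination` (`sigmaMaxModifications_dim_le_two`, p148824) —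
`hsRung_one`, `hsRung_two_of_cjs` below.

**Rung (this line's load-bearing stub).** `stub_hsCurveLocus3 : HSRung 3 1 3` — Thm. 6.28 with
(3e) DROPPED (in dimension `3`, `ē_x ≤ 3` is automatic), (1) and (2) kept: `Σ^max`-modifications
at level `3` for threefolds over fields of characteristic `p ≥ 3` whose Hilbert–Samuel locus
`X_max(3)` has dimension `≤ 1`. Located stopping point of the floor's proof: CJS O2 — the key
Theorem 6.40 is proved for `ē_x = 2` only (fundamental units need `P(Dir_x) ≅ ℙ¹`; for `ē_x = 3`
the near locus of a point blow-up lies in a `ℙ²` and hypothesis (2) is not stable), LNM 2270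
pp. 4, 12, 104–107.

**Ladder.** `HSRung 3 1 3 → stub_corridor3_residual (dim X = 3, corridor, s = 2 or p = 2) →
stub_dim_ge_four_base → C` (`SigmaMaxModifications_of`, via
`sigmaMaxModifications_of_base_cores`) `→ S` (`resolution_of_stubs`, via the landed `closes`).
On-path: `C → HSRung d s p₀` for all parameters (`hsRung_of_sigmaMaxModifications`).
-/

set_option linter.dupNamespace false -- mandated namespace of this single-conjunct summit

noncomputable section

open CategoryTheory AlgebraicGeometry TopologicalSpace Topology
open Literature.AlgebraicGeometry.Resolution Literature.RingTheory.HilbertSamuel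
open Summit.ResolutionOfSingularities.ResolutionOfSingularities.Theses.HilbertSamuelElimination
open Summit.ResolutionOfSingularities.ResolutionOfSingularities.Theorems.SigmaMaxModifications.Sketch

namespace Summit.ResolutionOfSingularities.ResolutionOfSingularities.Cruxes.SigmaMaxModifications.HsCurveLocus

/-! ## The graded family -/

/-- `B(X, N)`: the seven-clause body of the crux at level `N` — a proper `π : X' ⟶ X` with `X'`
reduced of dimension `≤ N`, an isomorphism over every open inside `X ∖ X_max(N)` with dense
preimage of `X ∖ X_max(N)`, `H^N` non-increasing, and (ME2) no maximal value of `Σ_X(N)` is a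
value of `Σ_{X'}(N)` (CJS Def. 6.15 in modification form, tree vocabulary
`Scheme.hsFun / hsMaxLocus / hsValues`). [cite: CossartJannsenSaito2020, Def. 6.15] -/
def HSBody (X : Scheme.{0}) (N : ℕ) : Prop :=
  ∃ (X' : Scheme.{0}) (π : X' ⟶ X), IsProper π ∧ IsReduced X' ∧
    topologicalKrullDim X' ≤ (N : WithBot ℕ∞) ∧
    (∀ U : X.Opens, (U : Set X) ⊆ (Scheme.hsMaxLocus X N)ᶜ → IsIso (π ∣_ U)) ∧
    Dense ((fun x' => π.base x') ⁻¹' (Scheme.hsMaxLocus X N)ᶜ) ∧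
    (∀ x' : X', Scheme.hsFun X' N x' ≤ Scheme.hsFun X N (π.base x')) ∧
    ∀ ν : ℕ → ℕ, Maximal (· ∈ Scheme.hsValues X N) ν → ν ∉ Scheme.hsValues X' N

/-- **The rung family `HSRung d s p₀`** (the crux graded by the hypotheses of CJS Thm. 6.28):
`Σ^max`-modifications at the binding level `d` for every reduced separated finite-type non-regular
`X/k`, `char k = p ≥ p₀`, `dim X ≤ d`, whose Hilbert–Samuel locus `X_max(d)` has (subspace)
dimension `≤ s`. Harder as `d ↑`, `s ↑`, `p₀ ↓`; the crux is `∀ d, HSRung d d 2` up to level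
raising. [cite: CossartJannsenSaito2020, Thm. 6.28, Def. 6.15] -/
def HSRung (d s p₀ : ℕ) : Prop :=
  ∀ p : ℕ, p.Prime → p₀ ≤ p → ∀ (k : Type) [Field k] [CharP k p] (X : Scheme.{0})
    (f : X ⟶ Spec (.of k)), IsSeparated f → LocallyOfFiniteType f → QuasiCompact f →
    IsReduced X → ¬ Scheme.IsRegular X → topologicalKrullDim X ≤ (d : WithBot ℕ∞) →
    topologicalKrullDim (Scheme.hsMaxLocus X d) ≤ (s : WithBot ℕ∞) → HSBody X d

/-! ## Stubs: the two printed theorems (named facts of the tree; shared with line `Sketch`) -/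

/-- **STUB (known in print): `Σ^max`-eliminations of reduced excellent surfaces** —
the tree's named fact `CossartJannsenSaito2020_sigmaMaxElimination` (CJS Def. 6.15 with
Thm. 6.28 and Thm. 3.10 (1), `d ≤ 2`). [cite: CossartJannsenSaito2020, Thm. 6.28, Def. 6.15] -/
theorem stub_cjsSigmaMaxElimination : CossartJannsenSaito2020_sigmaMaxElimination.{0} := by
  sorry

/-- **STUB (known in print): Cossart–Piltant 2019, Thm. 1.1** — the tree's named fact
`CossartPiltant2019General`. [cite: CossartPiltant2019, Thm. 1.1] -/
theorem stub_cossartPiltant2019General : CossartPiltant2019General.{0} := by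
  sorry

/-! ## Stubs: the rung and the two gaps above it -/

/-- **STUB (OPEN — THE RUNG, load-bearing): `HSRung 3 1 3`.** For `X/k` reduced separated of
finite type, not regular, `char k = p ≥ 3`, `dim X ≤ 3`, with `dim X_max(3) ≤ 1`: a
`Σ^max`-modification at level `3`. This is CJS Thm. 6.28 in dimension `3` with hypothesis (3e)
(`ē_x ≤ 2`) removed and (1), (2) kept; the isolated-locus part is Cossart–Piltant glued with the
identity (`sigmaMaxModifications_dim_le_three_of_isolated`), the content is the corridor points
with `ē_x = 3`, where Thm. 6.40's fundamental units are not available (O2).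
[cite: CossartJannsenSaito2020, Thm. 6.28, Thm. 6.40, Rem. 6.29] [cite: CossartPiltant2019, Thm. 1.1] -/
theorem stub_hsCurveLocus3 : HSRung 3 1 3 := by
  sorry

/-- **STUB (OPEN — GAP₁, the rest of `Corridor3@3`).** Threefolds (`dim X = 3`) in the corridor
case (`X_max(3)` meets the closure of `Sing X ∖ X_max(3)`) NOT covered by the rung: `p = 2`
(CJS O1: Thm. 3.14 needs `char ≥ dim X/2 + 1`) or a surface-dimensional Hilbert–Samuel locus
(CJS hypothesis (2) fails; Rem. 6.29's cycles). [cite: CossartJannsenSaito2020, Rem. 6.29, Thm. 3.14] -/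
theorem stub_corridor3_residual :
    ∀ p : ℕ, p.Prime → ∀ (k : Type) [Field k] [CharP k p] (X : Scheme.{0})
      (f : X ⟶ Spec (.of k)), IsSeparated f → LocallyOfFiniteType f → QuasiCompact f →
      IsReduced X → ¬ Scheme.IsRegular X → ((3 : ℕ) : WithBot ℕ∞) ≤ topologicalKrullDim X →
      topologicalKrullDim X ≤ ((3 : ℕ) : WithBot ℕ∞) →
      ¬ Disjoint (closure ((Scheme.regularLocus X)ᶜ \ Scheme.hsMaxLocus X 3))
          (Scheme.hsMaxLocus X 3) →
      (p < 3 ∨ ¬ topologicalKrullDim (Scheme.hsMaxLocus X 3) ≤ ((1 : ℕ) : WithBot ℕ∞)) →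
        HSBody X 3 := by
  sorry

/-- **STUB (OPEN — GAP₂ = `DimGe4@base`, verbatim the lead's `stub_dim_ge_four_base`).**
`Σ^max`-modifications at level `N = dim X` for `dim X ≥ 4`; nothing in print.
[cite: CossartJannsenSaito2020, Rem. 6.29] -/
theorem stub_dim_ge_four_base :
    ∀ p : ℕ, p.Prime → ∀ (k : Type) [Field k] [CharP k p] (X : Scheme.{0})
      (f : X ⟶ Spec (.of k)), IsSeparated f → LocallyOfFiniteType f → QuasiCompact f →
      IsReduced X → ¬ Scheme.IsRegular X → ∀ N : ℕ, 4 ≤ N →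
      (N : WithBot ℕ∞) ≤ topologicalKrullDim X → topologicalKrullDim X ≤ (N : WithBot ℕ∞) →
        HSBody X N := by
  sorry

/-! ## Composition (sorry-free) -/

/-- `Corridor3@3` (the `hcor` hypothesis of `sigmaMaxModifications_of_base_cores`) from the rung and
GAP₁, by cases on `p < 3` and on `dim X_max(3) ≤ 1`. -/
theorem corridor3_of_rung_of_residual (hR : HSRung 3 1 3)
    (hres : ∀ p : ℕ, p.Prime → ∀ (k : Type) [Field k] [CharP k p] (X : Scheme.{0})
      (f : X ⟶ Spec (.of k)), IsSeparated f → LocallyOfFiniteType f → QuasiCompact f →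
      IsReduced X → ¬ Scheme.IsRegular X → ((3 : ℕ) : WithBot ℕ∞) ≤ topologicalKrullDim X →
      topologicalKrullDim X ≤ ((3 : ℕ) : WithBot ℕ∞) →
      ¬ Disjoint (closure ((Scheme.regularLocus X)ᶜ \ Scheme.hsMaxLocus X 3))
          (Scheme.hsMaxLocus X 3) →
      (p < 3 ∨ ¬ topologicalKrullDim (Scheme.hsMaxLocus X 3) ≤ ((1 : ℕ) : WithBot ℕ∞)) →
        HSBody X 3) :
    ∀ p : ℕ, p.Prime → ∀ (k : Type) [Field k] [CharP k p] (X : Scheme.{0})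
      (f : X ⟶ Spec (.of k)), IsSeparated f → LocallyOfFiniteType f → QuasiCompact f →
      IsReduced X → ¬ Scheme.IsRegular X → ((3 : ℕ) : WithBot ℕ∞) ≤ topologicalKrullDim X →
      topologicalKrullDim X ≤ ((3 : ℕ) : WithBot ℕ∞) →
      ¬ Disjoint (closure ((Scheme.regularLocus X)ᶜ \ Scheme.hsMaxLocus X 3))
          (Scheme.hsMaxLocus X 3) →
        ∃ (X' : Scheme.{0}) (π : X' ⟶ X), IsProper π ∧ IsReduced X' ∧
          topologicalKrullDim X' ≤ ((3 : ℕ) : WithBot ℕ∞) ∧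
          (∀ U : X.Opens, (U : Set X) ⊆ (Scheme.hsMaxLocus X 3)ᶜ → IsIso (π ∣_ U)) ∧
          Dense ((fun x' => π.base x') ⁻¹' (Scheme.hsMaxLocus X 3)ᶜ) ∧
          (∀ x' : X', Scheme.hsFun X' 3 x' ≤ Scheme.hsFun X 3 (π.base x')) ∧
          ∀ ν : ℕ → ℕ, Maximal (· ∈ Scheme.hsValues X 3) ν → ν ∉ Scheme.hsValues X' 3 := by
  intro p hp k _ _ X f hsep hft hqc hred hreg hge hle hcor
  rcases Nat.lt_or_ge p 3 with hp3 | hp3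
  · exact hres p hp k X f hsep hft hqc hred hreg hge hle hcor (Or.inl hp3)
  · by_cases hs : topologicalKrullDim (Scheme.hsMaxLocus X 3) ≤ ((1 : ℕ) : WithBot ℕ∞)
    · exact hR p hp hp3 k X f hsep hft hqc hred hreg hle hs
    · exact hres p hp k X f hsep hft hqc hred hreg hge hle hcor (Or.inr hs)

/-- **The crux from the stubs — THE REGISTERED COMPOSITION** (first and hypothesis-free theorem
concluding the crux; sorries only inside the five `stub_*` it plugs in): printed theorems, rung,
GAP₁, GAP₂ `⊢ SigmaMaxModifications` through the landed level induction
`sigmaMaxModifications_of_base_cores` (p164038). [cite: CossartJannsenSaito2020, Def. 6.15, Cor. 6.18, Rem. 6.29] -/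
theorem SigmaMaxModifications_of : SigmaMaxModifications :=
  sigmaMaxModifications_of_base_cores stub_cjsSigmaMaxElimination stub_cossartPiltant2019General
    (corridor3_of_rung_of_residual stub_hsCurveLocus3 stub_corridor3_residual) stub_dim_ge_four_base

/-- **The whole ladder reaches the summit BY NAME, from the five stub STATEMENTS as explicit
hypotheses (closed term, no sorry at all — documentation of exactly what the line assumes):**
`sigmaMaxModifications_of_base_cores` gives `C` and the landed `C → S`
(`Theses.HilbertSamuelElimination.closes` with `Theorems.ModificationsResolve_proof`, CJS Cor. 6.18)
gives `S`. (Only ONE theorem of this file concludes the crux itself: `SigmaMaxModifications_of`.)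
[cite: CossartJannsenSaito2020, Cor. 6.18] -/
theorem resolution_of_stubs :
    CossartJannsenSaito2020_sigmaMaxElimination.{0} → CossartPiltant2019General.{0} →
    HSRung 3 1 3 →
    (∀ p : ℕ, p.Prime → ∀ (k : Type) [Field k] [CharP k p] (X : Scheme.{0})
      (f : X ⟶ Spec (.of k)), IsSeparated f → LocallyOfFiniteType f → QuasiCompact f →
      IsReduced X → ¬ Scheme.IsRegular X → ((3 : ℕ) : WithBot ℕ∞) ≤ topologicalKrullDim X →
      topologicalKrullDim X ≤ ((3 : ℕ) : WithBot ℕ∞) →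
      ¬ Disjoint (closure ((Scheme.regularLocus X)ᶜ \ Scheme.hsMaxLocus X 3))
          (Scheme.hsMaxLocus X 3) →
      (p < 3 ∨ ¬ topologicalKrullDim (Scheme.hsMaxLocus X 3) ≤ ((1 : ℕ) : WithBot ℕ∞)) →
        HSBody X 3) →
    (∀ p : ℕ, p.Prime → ∀ (k : Type) [Field k] [CharP k p] (X : Scheme.{0})
      (f : X ⟶ Spec (.of k)), IsSeparated f → LocallyOfFiniteType f → QuasiCompact f →
      IsReduced X → ¬ Scheme.IsRegular X → ∀ N : ℕ, 4 ≤ N →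
      (N : WithBot ℕ∞) ≤ topologicalKrullDim X → topologicalKrullDim X ≤ (N : WithBot ℕ∞) →
        HSBody X N) →
    _root_.ResolutionOfSingularities :=
  fun hCJS hCP hR hres hge4 =>
    closes (sigmaMaxModifications_of_base_cores hCJS hCP (corridor3_of_rung_of_residual hR hres) hge4)
      Summit.ResolutionOfSingularities.ResolutionOfSingularities.Theorems.ModificationsResolve_proof

/-! ## On-path and floor (sorry-free) -/

/-- **On-path `C → Rung`:** every rung is an instance of the crux (level `N = d`; the inline
`H^N` of the route decl is `Scheme.hsFun` by `rfl`). [cite: CossartJannsenSaito2020, Def. 6.15] -/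
theorem hsRung_of_sigmaMaxModifications (d s p₀ : ℕ) : SigmaMaxModifications → HSRung d s p₀ := by
  intro h p hp _ k _ _ X f hsep hft hqc hred hreg hdim _
  exact h p hp k X f hsep hft hqc hred hreg d hdim

/-- **Floor, `d ≤ 1` (in the tree, unconditional):** curves, by `stub_curve` (p156715) fed by
`stub_curveResolution` (p156708). [cite: CossartJannsenSaito2020, Def. 6.15] -/
theorem hsRung_one (s p₀ : ℕ) : HSRung 1 s p₀ := by
  intro p _ _ k _ _ X f hsep hft hqc hred hreg hdim _
  exact stub_curve stub_curveResolution k X f hsep hft hqc hred hreg hdim 1 hdim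

/-- **Floor, `d = 0`:** also curves. -/
theorem hsRung_zero (s p₀ : ℕ) : HSRung 0 s p₀ := by
  intro p _ _ k _ _ X f hsep hft hqc hred hreg hdim _
  exact stub_curve stub_curveResolution k X f hsep hft hqc hred hreg
    (hdim.trans (by exact_mod_cast (by omega : 0 ≤ 1))) 0 hdim

/-- **Floor, `d = 2` (CJS Thm. 6.28 for surfaces, in the tree modulo the named fact):**
`sigmaMaxModifications_dim_le_two` (p148824). [cite: CossartJannsenSaito2020, Thm. 6.28, Def. 6.15] -/
theorem hsRung_two_of_cjs (h : CossartJannsenSaito2020_sigmaMaxElimination.{0}) (s p₀ : ℕ) :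
    HSRung 2 s p₀ := by
  intro p _ _ k _ _ X f hsep hft hqc hred hreg hdim _
  exact sigmaMaxModifications_dim_le_two h k X f hft hqc hred hreg (by exact_mod_cast hdim)

/-- **Floor, `d = 3`, `s`-free but ISOLATED locus (Cossart–Piltant glued with the identity):** the
part of `HSRung 3 s p₀` where `X_max(3)` is disjoint from the closure of `Sing X ∖ X_max(3)`,
`sigmaMaxModifications_dim_le_three_of_isolated` (p154168) with `X_max(3)` closed by the sharp
semicontinuity (p157713/p158563). [cite: CossartPiltant2019, Thm. 1.1] [cite: CossartJannsenSaito2020, Thm. 2.33] -/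
theorem hsBody_three_of_isolated (hCP : CossartPiltant2019General.{0}) (k : Type) [Field k]
    (X : Scheme.{0}) (f : X ⟶ Spec (.of k)) (hsep : IsSeparated f) (hft : LocallyOfFiniteType f)
    (hqc : QuasiCompact f) (hred : IsReduced X) (hreg : ¬ Scheme.IsRegular X)
    (hle : topologicalKrullDim X ≤ ((3 : ℕ) : WithBot ℕ∞))
    (hdisj : Disjoint (closure ((Scheme.regularLocus X)ᶜ \ Scheme.hsMaxLocus X 3))
      (Scheme.hsMaxLocus X 3)) : HSBody X 3 := by
  have hcl : IsClosed (Scheme.hsMaxLocus X 3) :=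
    (stub_isClosed_hsMaxLocus_over_field stub_hsFun_le_of_specializes_over_field k X f hft
      hqc 3 hle).2
  exact sigmaMaxModifications_dim_le_three_of_isolated hCP k X f hsep hft hqc hred hreg
    (by exact_mod_cast hle) 3 hle hcl hdisj

/-! ## F3 — the rung specialises to its floor (sorry-free; mirrored in `Lines/hs_curve_locus_special.lean`) -/

/-- F3: the rung family at the floor parameters `d = 2` (any `s`, `p₀`) from the floor decl. -/
theorem special_floor_two (h : CossartJannsenSaito2020_sigmaMaxElimination.{0}) (s p₀ : ℕ) :
    HSRung 2 s p₀ := by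
  simpa [HSRung] using hsRung_two_of_cjs h s p₀

/-- F3, unconditional floor at the rung's own `s = 1`, `p₀ = 3`: curves. -/
theorem special_floor_one : HSRung 1 1 3 := hsRung_one 1 3

/-- The known PART of the rung `HSRung 3 1 3` (isolated Hilbert–Samuel locus, CP2019 glued with the
identity): the rung's statement with the extra disjointness hypothesis. -/
theorem special_rung_isolated_part (hCP : CossartPiltant2019General.{0}) :
    ∀ p : ℕ, p.Prime → 3 ≤ p → ∀ (k : Type) [Field k] [CharP k p] (X : Scheme.{0})
      (f : X ⟶ Spec (.of k)), IsSeparated f → LocallyOfFiniteType f → QuasiCompact f →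
      IsReduced X → ¬ Scheme.IsRegular X → topologicalKrullDim X ≤ ((3 : ℕ) : WithBot ℕ∞) →
      topologicalKrullDim (Scheme.hsMaxLocus X 3) ≤ ((1 : ℕ) : WithBot ℕ∞) →
      Disjoint (closure ((Scheme.regularLocus X)ᶜ \ Scheme.hsMaxLocus X 3))
        (Scheme.hsMaxLocus X 3) → HSBody X 3 := by
  intro p _ _ k _ _ X f hsep hft hqc hred hreg hle _ hdisj
  exact hsBody_three_of_isolated hCP k X f hsep hft hqc hred hreg hle hdisj

end Summit.ResolutionOfSingularities.ResolutionOfSingularities.Cruxes.SigmaMaxModifications.HsCurveLocus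

end
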